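import Summits.QuantumFields.BalabanUV.T4Continuum.Support.NE3MajorantProfileTower
import HarnessLib

/-!
# T⁴ programme, node NE3, route Π (Γ″) · γ4″ (file B3) — THE FRAME FUNCTIONAL TOWER, UNROLLED AND EVALUATED k-FREE
# (constants: `≤ 4d·L^{j+1}·s`; Coulomb profiles with `p ≥ 2`: `≤ 2dL·cP·sup_i Kprod`)

NE3 formalisation swarm `b2b-balaban-t4-ne3-formalise-*`, LEAF PROVER 04 (gen 8), written for the Π-C-3γ holder `leaf-02-g8` (γ4″).
Sequel of `NE3MajorantProfileTower`.

CONTENT (all [folklore]; 0 sorry; no new data):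
* `frameMaj_succ_eq_sum` — `frameMaj d L (j+1) x ω z = Σ_{i ≤ j} treeStep L (majIter d L i x ω) (L^{j−i}•z)`: the accumulated frames enter
  ADDITIVELY, each level's tree functional of that level's majorant (file A′'s recursion unrolled);
* level sums: `Ssum` and `Kprod` are monotone in the number of levels; `Σ_{i≤j} L^i ≤ 2L^j` (`L ≥ 2`); `Σ_{i≤j} L^i∕(L^i)^p ≤ 2` (`p ≥ 2`, `L ≥ 2`);
* **`frameMaj_const_le`**: `frameMaj d L (j+1) x (const s) z ≤ 4d·L^{j+1}·s` in the class (`Ssum d L (j+1) x ≤ 1`, `L ≥ 2`);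
* **`frameMaj_profW_le`**: `frameMaj d L (j+1) x (profW p c) z ≤ 2dL·cP d p·K` whenever `Kprod d L p i x ≤ K` for all `i ≤ j` (`2 ≤ p`, `p+1 ≤ d`).

HONEST: positivity bookkeeping on OUR frame; nothing about minimisers, (Π-REG-γ″), Π-C-3γ″, T-E_w♯ or NE3 is asserted; NE3 NOT proved; spine PROVED 0∕9;
finite T⁴ rung (B)+1 — NOT infinite volume, NOT mass gap, NOT BetaPertH, NOT Clay.  PLACEMENT: `Summits/QuantumFields/BalabanUV/` (cell rule).
-/

set_option autoImplicit false

open scoped BigOperators Matrix.Norms.L2Operator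
open Finset

namespace Summit.QuantumFields.BalabanUV.T4Continuum.NE3MajorantProfileFrames

open Literature.MathematicalPhysics.QuantumFieldTheory.Balaban1983to89
open B7Prop1Explicit B7Prop2Explicit
open AveragingDeficitCounting (blockIdx)
open AveragingDeficitTwoLevelPrep (prop1Radius)
open AveragingDeficitMultiLevelPrep (LevelSmall prop1Radius_nonneg)
open BlockAverageVaryHolo (nbRad)
open NE3CovariantLineSumsError (Csup wC Ssum Ssum_succ wC_nonneg Ssum_nonneg)
open NE3QbarIterMajorant (majIter majIter_zero majIter_succ majIter_nonneg stepMaj)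
open NE3DirIterMajorant (treeStep frameMaj frameMaj_zero frameMaj_succ)
open NE3MajorantProfile (prof profW prof_nonneg prof_le_one cP cP_nonneg)
open NE3MajorantProfileTower (treeStep_le_of_sup Lprod Lprod_le majIter_const_le cK cK_nonneg Kprod one_le_Kprod Kprod_le_two
  majIter_iterate_profW_le)

noncomputable section

variable {d : ℕ}

/-! ## §1 The frame tower unrolled -/

/-- **THE ACCUMULATED FRAMES ENTER ADDITIVELY**: `frameMaj d L (j+1) x ω z = Σ_{i ≤ j} treeStep L (majIter d L i x ω) (L^{j−i}•z)`. [folklore] -/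
theorem frameMaj_succ_eq_sum (d L : ℕ) : ∀ (j : ℕ) (x : ℝ) (ω : Site d → Fin d → ℝ) (z : Site d),
    frameMaj d L (j + 1) x ω z = ∑ i ∈ range (j + 1), treeStep L (majIter d L i x ω) (((L : ℤ) ^ (j - i)) • z)
  | 0, x, ω, z => by
      rw [frameMaj_succ]
      simp [majIter_zero]
  | j + 1, x, ω, z => by
      rw [frameMaj_succ, frameMaj_succ_eq_sum d L j (prop1Radius d L x) (stepMaj d L x ω) z, Finset.sum_range_succ' _ (j + 1)]
      congr 1
      refine Finset.sum_congr rfl fun i hi => ?_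
      rw [Finset.mem_range] at hi
      rw [← majIter_succ, show j + 1 - (i + 1) = j - i by omega]

/-! ## §2 Level sums -/

/-- `Ssum` grows with the number of levels (`x ≥ 0`). [folklore] -/
theorem Ssum_le_succ (d L : ℕ) : ∀ (j : ℕ) {x : ℝ}, 0 ≤ x → Ssum d L j x ≤ Ssum d L (j + 1) x
  | 0, _, hx => by rw [Ssum_succ]; simp only [Ssum, add_zero]; exact wC_nonneg d L hx
  | j + 1, _, hx => by
      rw [Ssum_succ, Ssum_succ]
      exact add_le_add le_rfl (Ssum_le_succ d L j (prop1Radius_nonneg hx))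

/-- `Ssum i ≤ Ssum j` for `i ≤ j` (`x ≥ 0`). [folklore] -/
theorem Ssum_mono (d L : ℕ) {i j : ℕ} (hij : i ≤ j) {x : ℝ} (hx : 0 ≤ x) : Ssum d L i x ≤ Ssum d L j x := by
  induction j, hij using Nat.le_induction with
  | base => exact le_rfl
  | succ j _ ih => exact ih.trans (Ssum_le_succ d L j hx)

/-- `Σ_{i ≤ j} L^i ≤ 2·L^j` for `L ≥ 2`. [folklore] -/
theorem sum_pow_le {L : ℕ} (hL : 2 ≤ L) : ∀ j : ℕ, ∑ i ∈ range (j + 1), (L : ℝ) ^ i ≤ 2 * (L : ℝ) ^ j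
  | 0 => by simp
  | j + 1 => by
      rw [Finset.sum_range_succ]
      have ih := sum_pow_le hL j
      have hL2 : (2 : ℝ) ≤ L := by exact_mod_cast hL
      have hLj : (0 : ℝ) ≤ (L : ℝ) ^ j := by positivity
      calc _ ≤ 2 * (L : ℝ) ^ j + (L : ℝ) ^ (j + 1) := add_le_add ih le_rfl
        _ ≤ (L : ℝ) ^ (j + 1) + (L : ℝ) ^ (j + 1) := by rw [pow_succ]; nlinarith
        _ = 2 * (L : ℝ) ^ (j + 1) := by ring

/-- The dilution factors are summable for `p ≥ 2`, `L ≥ 2`: `L^i ∕ (L^i)^p ≤ (1∕2)^i`. [folklore] -/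
theorem rho_le_half_pow {L : ℕ} (hL : 2 ≤ L) {p : ℕ} (hp : 2 ≤ p) (i : ℕ) : (L : ℝ) ^ i / ((L : ℝ) ^ i) ^ p ≤ (1 / 2) ^ i := by
  have hL2 : (2 : ℝ) ≤ L := by exact_mod_cast hL
  have hLi : (1 : ℝ) ≤ (L : ℝ) ^ i := one_le_pow₀ (by linarith)
  have hLi0 : (0 : ℝ) < (L : ℝ) ^ i := by positivity
  obtain ⟨q, rfl⟩ : ∃ q, p = q + 2 := ⟨p - 2, by omega⟩
  rw [div_le_iff₀ (by positivity), pow_add, pow_two]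
  have h1 : (1 : ℝ) ≤ ((L : ℝ) ^ i) ^ q := one_le_pow₀ hLi
  have h2 : ((1 : ℝ) / 2) ^ i * (L : ℝ) ^ i = ((L : ℝ) / 2) ^ i := by rw [← mul_pow]; ring
  have h3 : (1 : ℝ) ≤ ((L : ℝ) / 2) ^ i := one_le_pow₀ (by linarith)
  calc (L : ℝ) ^ i = 1 * (1 * (L : ℝ) ^ i) := by ring
    _ ≤ ((L : ℝ) / 2) ^ i * (((L : ℝ) ^ i) ^ q * (L : ℝ) ^ i) := by gcongr
    _ = (1 / 2) ^ i * (((L : ℝ) ^ i) ^ q * ((L : ℝ) ^ i * (L : ℝ) ^ i)) := by rw [← h2]; ring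

/-- `Σ_{i ≤ j} L^i∕(L^i)^p ≤ 2` for `p ≥ 2`, `L ≥ 2`. [folklore] -/
theorem sum_rho_le_two {L : ℕ} (hL : 2 ≤ L) {p : ℕ} (hp : 2 ≤ p) (j : ℕ) : ∑ i ∈ range (j + 1), (L : ℝ) ^ i / ((L : ℝ) ^ i) ^ p ≤ 2 := by
  calc _ ≤ ∑ i ∈ range (j + 1), ((1 : ℝ) / 2) ^ i := Finset.sum_le_sum fun i _ => rho_le_half_pow hL hp i
    _ = (((1 : ℝ) / 2) ^ (j + 1) - 1) / (1 / 2 - 1) := geom_sum_eq (by norm_num) _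
    _ ≤ 2 := by
        have : (0 : ℝ) ≤ ((1 : ℝ) / 2) ^ (j + 1) := by positivity
        rw [div_le_iff_of_neg (by norm_num)]
        linarith

/-! ## §3 The frame tower on constants and on Coulomb profiles -/

/-- **FRAMES, σ-TIER**: in the class (`L ≥ 2`, `x ≥ 0`, `Ssum d L (j+1) x ≤ 1`), `frameMaj d L (j+1) x (const s) z ≤ 4d·L^{j+1}·s` (`s ≥ 0`):
each level contributes `dL × 2L^i·s`. [folklore] -/
theorem frameMaj_const_le {L : ℕ} (hL : 2 ≤ L) (j : ℕ) {x : ℝ} (hx : 0 ≤ x) (hS : Ssum d L (j + 1) x ≤ 1) {s : ℝ} (hs : 0 ≤ s) (z : Site d) :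
    frameMaj d L (j + 1) x (fun (_ : Site d) (_ : Fin d) => s) z ≤ 4 * d * (L : ℝ) ^ (j + 1) * s := by
  have hL1 : 1 ≤ L := by omega
  rw [frameMaj_succ_eq_sum]
  have hterm : ∀ i ∈ range (j + 1), treeStep L (majIter d L i x (fun (_ : Site d) (_ : Fin d) => s)) (((L : ℤ) ^ (j - i)) • z)
      ≤ (d * L : ℝ) * (2 * (L : ℝ) ^ i * s) := by
    intro i hi
    rw [Finset.mem_range] at hi
    have hSi : Ssum d L i x ≤ 1 := (Ssum_mono d L (by omega : i ≤ j + 1) hx).trans hS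
    have hLp := Lprod_le (d := d) hL i hx hSi
    refine treeStep_le_of_sup hL1 (by positivity) fun y' μ _ => ?_
    exact (majIter_const_le hL1 i hx hs y' μ).trans (mul_le_mul_of_nonneg_right hLp hs)
  refine (Finset.sum_le_sum hterm).trans ?_
  have hsum := sum_pow_le hL j
  have hd0 : (0 : ℝ) ≤ d := Nat.cast_nonneg d
  have hL0 : (0 : ℝ) ≤ L := Nat.cast_nonneg L
  calc ∑ i ∈ range (j + 1), (d * L : ℝ) * (2 * (L : ℝ) ^ i * s) = 2 * (d * L) * s * ∑ i ∈ range (j + 1), (L : ℝ) ^ i := by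
        rw [Finset.mul_sum]; exact Finset.sum_congr rfl fun i _ => by ring
    _ ≤ 2 * (d * L) * s * (2 * (L : ℝ) ^ j) := mul_le_mul_of_nonneg_left hsum (by positivity)
    _ = 4 * d * (L : ℝ) ^ (j + 1) * s := by ring

/-- **FRAMES, COULOMB TIER**: for `2 ≤ p`, `p + 1 ≤ d`, `L ≥ 2`, `x ≥ 0` and a bound `Kprod d L p i x ≤ K` at every level `i ≤ j`,
`frameMaj d L (j+1) x (profW p c) z ≤ 2dL·cP d p·K`: level `i` contributes `dL × cP·K·L^i∕(L^i)^p` (the profile `≤ 1`), and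
`Σ_i L^i∕(L^i)^p ≤ 2`. [folklore] -/
theorem frameMaj_profW_le (hd : 1 ≤ d) {p : ℕ} (hp2 : 2 ≤ p) (hp : p + 1 ≤ d) {L : ℕ} (hL : 2 ≤ L) (j : ℕ) {x : ℝ} (hx : 0 ≤ x)
    {K : ℝ} (hK : ∀ i ≤ j, Kprod d L p i x ≤ K) (c z : Site d) :
    frameMaj d L (j + 1) x (profW p c) z ≤ 2 * (d * L) * cP d p * K := by
  have hL1 : 1 ≤ L := by omega
  have hK0 : 0 ≤ K := le_trans (le_trans zero_le_one (one_le_Kprod d L p 0 hx)) (hK 0 (Nat.zero_le _))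
  rw [frameMaj_succ_eq_sum]
  have hterm : ∀ i ∈ range (j + 1), treeStep L (majIter d L i x (profW p c)) (((L : ℤ) ^ (j - i)) • z)
      ≤ (d * L : ℝ) * (cP d p * K * ((L : ℝ) ^ i / ((L : ℝ) ^ i) ^ p)) := by
    intro i hi
    rw [Finset.mem_range] at hi
    have hKi := hK i (by omega)
    refine treeStep_le_of_sup hL1 (by have := cP_nonneg d p; positivity) fun y' μ _ => ?_
    have h := majIter_iterate_profW_le hd (by omega) hp hL1 i 0 hx c y' μ
    rw [Function.iterate_zero, id_eq, zero_add] at h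
    have hρ0 : 0 ≤ (L : ℝ) ^ i / ((L : ℝ) ^ i) ^ p := by positivity
    calc majIter d L i x (profW p c) y' μ ≤ cP d p * Kprod d L p i x * ((L : ℝ) ^ i / ((L : ℝ) ^ i) ^ p) * prof p (blockIdx (L ^ i) c) y' := h
      _ ≤ cP d p * Kprod d L p i x * ((L : ℝ) ^ i / ((L : ℝ) ^ i) ^ p) * 1 := by
          refine mul_le_mul_of_nonneg_left (prof_le_one _ _ _) ?_
          have := cP_nonneg d p; have := one_le_Kprod d L p i hx; positivity
      _ ≤ cP d p * K * ((L : ℝ) ^ i / ((L : ℝ) ^ i) ^ p) := by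
          rw [mul_one]; exact mul_le_mul_of_nonneg_right (mul_le_mul_of_nonneg_left hKi (cP_nonneg d p)) hρ0
  refine (Finset.sum_le_sum hterm).trans ?_
  have hsum := sum_rho_le_two hL hp2 j
  have hc := cP_nonneg d p
  calc ∑ i ∈ range (j + 1), (d * L : ℝ) * (cP d p * K * ((L : ℝ) ^ i / ((L : ℝ) ^ i) ^ p))
      = (d * L) * cP d p * K * ∑ i ∈ range (j + 1), (L : ℝ) ^ i / ((L : ℝ) ^ i) ^ p := by
        rw [Finset.mul_sum]; exact Finset.sum_congr rfl fun i _ => by ring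
    _ ≤ (d * L) * cP d p * K * 2 := mul_le_mul_of_nonneg_left hsum (by positivity)
    _ = 2 * (d * L) * cP d p * K := by ring

end

end Summit.QuantumFields.BalabanUV.T4Continuum.NE3MajorantProfileFrames
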